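import Literature.Computability.Complexity.IWReconstructionStageQueries
import HarnessLib

/-!
# IW98 Lemma 15, the construction: one run of the CIKK reconstruction as a weak stage (the candidate)

Literature / complexity — derandomization under a uniform assumption; sequel of
`IWReconstructionStageQueries.lean` (the run queries `IWStage.qryS` of the weak stage) and
`IWReconstructionEvaluator.lean` (the evaluator `IWRecon.evalFnIdx` of the circuits, reading the
distinguisher's index off the `pad` slot). Here the CANDIDATE map of the stage: on
`⟨⟨1ⁿ, ⟨z, run block⟩⟩, answers⟩` it assembles, from the first `runLen` run coins and the answers to
the `L²k` table queries and the `k` trusted-tuple queries, CIKK's hypothesis record of the run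
(`Learning.hypFn`, `LearnerHypFP.lean`) and writes the test index `z` into its pad
(`IWRecon.setPadFn`) — so that the candidate IS the circuit `IJKW-decoder ∘ GL ∘ NW-predictor` of
IW §2.4 for the sampled distinguisher `z`:

* `IWStage.prmRecP` — CIKK's parameter record `prmRec n k ℓ L kk KK t q κ` on `⟨1ⁿ, rb⟩`;
* **`IWStage.candS`** — the candidate map (`candS_mem_FP`);
* **`IWStage.candS_apply`** — its value when the answers are the `f`-values of the run queries (the
  list `SelectT.candOf` feeds it): `hypRec z q n k ℓ kk t (tables) f ω` with `ω = coinsToRun … (rb ↾ runLen)`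
  (`Learning.hypFn_apply`: the table answers satisfy `AnswersOK` by `qryS_apply_table`, the trusted
  values by `qryS_apply_trusted`);
* **`IWStage.evalFnIdx_candS`** — hence the evaluator computes the run's hypothesis
  `runHyp (learnerDesign …) (IWRecon.idxTest L'' z ℓ) f ω` (`IWRecon.evalFnIdx_apply`,
  `LearnerTablesFP.learnerTable_eq_tableList`).

Everything is proved; the definitions are explicit string functions (no named facts). (Sequel: the
weak success bound via `Learning.card_goodRun_ge` and the packaged `ReducibleUsing`.)

## References

* [ImpagliazzoWigderson2001] R. Impagliazzo, A. Wigderson, JCSS 63 (2001) 672–688, Lemma 15, §2.4.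
* [CarmosinoImpagliazzoKabanetsKolokolova2016] CCC 2016, §5 (complete algorithm), Thm. 5.1.
-/

noncomputable section

namespace Literature.Computability.Complexity

namespace IWStage

open _root_.Computability Polynomial Brick Plumb HashBricks Literature.Computability.Learning
  Literature.Computability.MetaComplexity Literature.Computability.MetaComplexity.MCSPVerif

variable (kF LF ℓF kkF KKF κF tF : List Bool → List Bool)

/-! ### The candidate map -/

/-- **CIKK's parameter record** `⟨1ⁿ, ⟨1ᵏ, ⟨1^ℓ, ⟨1ᴸ, ⟨1^kk, ⟨1^{KK}, ⟨1ᵗ, ⟨1^q, 1^κ⟩⟩⟩⟩⟩⟩⟩⟩` (`prmRec`)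
on `⟨1ⁿ, rb⟩`. [cite: CarmosinoImpagliazzoKabanetsKolokolova2016, §5] -/
def prmRecP : List Bool → List Bool :=
  fanoutFn nP (fanoutFn (kF ∘ nP) (fanoutFn (ℓF ∘ nP) (fanoutFn (LF ∘ nP) (fanoutFn (kkF ∘ nP) (fanoutFn (KKF ∘ nP)
    (fanoutFn (tF ∘ nP) (fanoutFn (qP kF) (κF ∘ nP))))))))

/-- The context `⟨1ⁿ, rb⟩` read off the candidate input `W = ⟨⟨1ⁿ, ⟨z, rb⟩⟩, ans⟩`. [folklore] -/
def ctxW : List Bool → List Bool := fanoutFn (fstF ∘ fstF) (sndF ∘ sndF ∘ fstF)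

/-- **The candidate map** on `W = ⟨⟨1ⁿ, ⟨z, rb⟩⟩, ans⟩`: `setPad ⟨z, hypFn ⟨PRM, ⟨rb ↾ runLen, ans ↾ (L²k + k)⟩⟩⟩`.
[cite: ImpagliazzoWigderson2001, §2.4 (Lemmas 18–20)] [cite: CarmosinoImpagliazzoKabanetsKolokolova2016, §5] -/
def candS : List Bool → List Bool :=
  IWRecon.setPadFn ∘ fanoutFn (fstF ∘ sndF ∘ fstF)
    (hypFn ∘ fanoutFn (prmRecP kF LF ℓF kkF KKF κF tF ∘ ctxW)
      (fanoutFn (segP kF LF ℓF kkF κF tF ∘ ctxW)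
        (takeFn ∘ fanoutFn (appF ∘ fanoutFn (llkP kF LF ∘ ctxW) (kF ∘ nP ∘ ctxW)) sndF)))

section FP

variable {kF LF ℓF kkF KKF κF tF} (hk : kF ∈ FP) (hL : LF ∈ FP) (hℓ : ℓF ∈ FP) (hkk : kkF ∈ FP) (hKK : KKF ∈ FP)
  (hκ : κF ∈ FP) (ht : tF ∈ FP)
include hk hL hℓ hkk hKK hκ ht

/-- `prmRecP` is in `FP`. [folklore] -/
theorem prmRecP_mem_FP : prmRecP kF LF ℓF kkF KKF κF tF ∈ FP :=
  fanoutFn_mem_FP fstF_mem_FP (fanoutFn_mem_FP (comp_mem_FP hk fstF_mem_FP) (fanoutFn_mem_FP (comp_mem_FP hℓ fstF_mem_FP)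
    (fanoutFn_mem_FP (comp_mem_FP hL fstF_mem_FP) (fanoutFn_mem_FP (comp_mem_FP hkk fstF_mem_FP) (fanoutFn_mem_FP (comp_mem_FP hKK fstF_mem_FP)
      (fanoutFn_mem_FP (comp_mem_FP ht fstF_mem_FP) (fanoutFn_mem_FP (qP_mem_FP hk) (comp_mem_FP hκ fstF_mem_FP))))))))

/-- **`candS ∈ FP`.** [cite: AroraBarakCC2009, §1.3] -/
theorem candS_mem_FP : candS kF LF ℓF kkF KKF κF tF ∈ FP := by
  have hctx : ctxW ∈ FP := fanoutFn_mem_FP (comp_mem_FP fstF_mem_FP fstF_mem_FP) (comp_mem_FP sndF_mem_FP (comp_mem_FP sndF_mem_FP fstF_mem_FP))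
  exact comp_mem_FP IWRecon.setPadFn_mem_FP (fanoutFn_mem_FP (comp_mem_FP fstF_mem_FP (comp_mem_FP sndF_mem_FP fstF_mem_FP))
    (comp_mem_FP hypFn_mem_FP (fanoutFn_mem_FP (comp_mem_FP (prmRecP_mem_FP hk hL hℓ hkk hKK hκ ht) hctx)
      (fanoutFn_mem_FP (comp_mem_FP (segP_mem_FP hk hL hℓ hkk hκ ht) hctx)
        (comp_mem_FP takeFn_mem_FP (fanoutFn_mem_FP (comp_mem_FP appF_mem_FP (fanoutFn_mem_FP
          (comp_mem_FP (llkP_mem_FP hk hL) hctx) (comp_mem_FP hk (comp_mem_FP fstF_mem_FP hctx)))) sndF_mem_FP))))))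

end FP

/-! ### Values -/

section Values

variable {kF LF ℓF kkF KKF κF tF} {n k ℓ kk κ t : ℕ}
  (hkF : kF (ones n) = ones k) (hLF : LF (ones n) = ones (2 ^ ℓ)) (hℓF : ℓF (ones n) = ones ℓ)
  (hkkF : kkF (ones n) = ones kk) (hKKF : KKF (ones n) = ones (2 ^ kk)) (hκF : κF (ones n) = ones κ) (htF : tF (ones n) = ones t)

/-- A map over `range k` is an `ofFn`. [folklore] -/
theorem map_range_eq_ofFn {α : Type} (g : ℕ → α) (k : ℕ) : (List.range k).map g = List.ofFn fun i : Fin k => g i := by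
  apply List.ext_getElem <;> simp

/-- A window of a mapped range (without trailing part). [folklore] -/
theorem drop_take_map_range' {α : Type} (b : ℕ → α) {M i K : ℕ} (h : i + K ≤ M) :
    (((List.range M).map b).drop i).take K = (List.range K).map fun v => b (i + v) := by
  apply List.ext_getElem
  · simp only [List.length_take, List.length_drop, List.length_map, List.length_range]; omega
  · intro v h1 h2
    have hv : v < K := by simpa using h2
    rw [List.getElem_take, List.getElem_drop, List.getElem_map, List.getElem_range, List.getElem_map, List.getElem_range]

variable (z rb : List Bool) (f' : List Bool → Bool)

include hkF hLF hℓF hkkF hKKF hκF htF in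
/-- Value of `prmRecP`. [folklore] -/
theorem prmRecP_apply : prmRecP kF LF ℓF kkF KKF κF tF (boolPair (ones n) rb) = prmRec n k ℓ (2 ^ ℓ) kk (2 ^ kk) t (qOf n k) κ := by
  simp [prmRecP, nP, hkF, hLF, hℓF, hkkF, hKKF, hκF, htF, qP_apply hkF, prmRec]

/-- Value of `ctxW`. [folklore] -/
@[simp] theorem ctxW_apply (u a : List Bool) : ctxW (boolPair (boolPair u (boolPair z rb)) a) = boolPair u rb := by
  simp [ctxW]

include hkF hLF hℓF hkkF hKKF hκF htF in
/-- **The candidate of a run when the answers are the `f`-values of its queries** (the list that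
`SelectT.candOf` feeds, of any length `nQ ≥ L²k + k`): CIKK's hypothesis record of the run with
coins `ω = coinsToRun … (rb ↾ runLen)`, its pad set to the distinguisher's index `z`.
[cite: ImpagliazzoWigderson2001, Lemma 15 and §2.4] [cite: CarmosinoImpagliazzoKabanetsKolokolova2016, §5] -/
theorem candS_apply (hκk : 2 ^ κ ≤ k) (hk : 0 < k) (hrb : runLen n k ℓ kk t (qOf n k) κ ≤ rb.length) {nQ : ℕ}
    (hnQ : 2 ^ ℓ * 2 ^ ℓ * k + k ≤ nQ) :
    candS kF LF ℓF kkF KKF κF tF (boolPair (boolPair (ones n) (boolPair z rb))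
        ((List.range nQ).map fun u => f' (qryS kF LF ℓF kkF κF tF (boolPair (boolPair (ones n) rb) (ones u))))) =
      hypRec z (qOf n k) n k ℓ kk t
        (List.ofFn fun j : Fin (2 ^ ℓ) =>
          learnerTable (knk_le_qOf n k) (fun v : Fin n → Bool => f' (List.ofFn v))
            (coinsToRun n k ℓ kk t (qOf n k) κ hk (rb.take (runLen n k ℓ kk t (qOf n k) κ))).1.1 j
            (coinsToRun n k ℓ kk t (qOf n k) κ hk (rb.take (runLen n k ℓ kk t (qOf n k) κ))).1.2.1)
        (fun v : Fin n → Bool => f' (List.ofFn v))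
        (coinsToRun n k ℓ kk t (qOf n k) κ hk (rb.take (runLen n k ℓ kk t (qOf n k) κ))) := by
  set seg := rb.take (runLen n k ℓ kk t (qOf n k) κ) with hseg
  have hsegl : seg.length = runLen n k ℓ kk t (qOf n k) κ := by rw [hseg, List.length_take, min_eq_left hrb]
  set b : ℕ → Bool := fun u => f' (qryS kF LF ℓF kkF κF tF (boolPair (boolPair (ones n) rb) (ones u))) with hb
  set ans' := (List.range (2 ^ ℓ * 2 ^ ℓ * k + k)).map b with hans'
  have htake : ((List.range nQ).map b).take (2 ^ ℓ * 2 ^ ℓ * k + k) = ans' := by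
    rw [← List.map_take, List.take_range, min_eq_left hnQ]
  -- the answers are correct for the tables and the trusted tuple
  have hansT : AnswersOK (knk_le_qOf n k) (fun v : Fin n → Bool => f' (List.ofFn v))
      (coinsToRun n k ℓ kk t (qOf n k) κ hk seg).1.1 (coinsToRun n k ℓ kk t (qOf n k) κ hk seg).1.2.1 ans' := by
    intro j c hj hc
    have h1 : j * 2 ^ ℓ + c < 2 ^ ℓ * 2 ^ ℓ :=
      calc j * 2 ^ ℓ + c < j * 2 ^ ℓ + 2 ^ ℓ := by omega
        _ = (j + 1) * 2 ^ ℓ := by ring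
        _ ≤ 2 ^ ℓ * 2 ^ ℓ := Nat.mul_le_mul_right _ hj
    have hwin : (j * 2 ^ ℓ + c) * k + k ≤ 2 ^ ℓ * 2 ^ ℓ * k + k := by nlinarith
    rw [hans', drop_take_map_range' b hwin, map_range_eq_ofFn]
    refine congrArg List.ofFn (funext fun blk => ?_)
    simp only [hb]
    rw [qryS_apply_table hkF hLF hℓF hkkF hκF htF rb hk hrb hj hc blk.isLt, ← hseg]
  have hansV : (ans'.drop (2 ^ ℓ * 2 ^ ℓ * k)).take k =
      List.ofFn ((fun v : Fin n → Bool => f' (List.ofFn v)) ∘ (coinsToRun n k ℓ kk t (qOf n k) κ hk seg).2.2.2.1) := by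
    rw [hans', drop_take_map_range' b le_rfl, map_range_eq_ofFn]
    refine congrArg List.ofFn (funext fun blk => ?_)
    simp only [hb, Function.comp_apply]
    rw [qryS_apply_trusted hkF hLF hℓF hkkF hκF htF rb hk hrb blk.isLt, ← hseg]
  have hLk : 2 ^ ℓ ≤ ans'.length := by
    rw [hans', List.length_map, List.length_range]
    have : 2 ^ ℓ ≤ 2 ^ ℓ * 2 ^ ℓ * k := by
      calc 2 ^ ℓ = 2 ^ ℓ * 1 * 1 := by ring
        _ ≤ 2 ^ ℓ * 2 ^ ℓ * k := by gcongr; exacts [Nat.one_le_two_pow, hk]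
    exact this.trans (Nat.le_add_right _ _)
  rw [candS, Function.comp_apply, fanoutFn_apply]
  simp only [Function.comp_apply, fanoutFn_apply, fstF_boolPair, sndF_boolPair, ctxW_apply, prmRecP_apply hkF hLF hℓF hkkF hKKF hκF htF,
    segP_apply hkF hLF hℓF hkkF hκF htF, llkP_apply hkF hLF, nP, hkF, appF_boolPair, takeFn_boolPair, List.length_append,
    List.length_replicate, htake, ← hseg]
  rw [hypFn_apply (knk_le_qOf n k) hκk hk _ seg hsegl ans' hansT hansV hLk, IWRecon.setPadFn_hypRec]

include hkF hLF hℓF hkkF hKKF hκF htF in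
/-- **The evaluator computes the run's hypothesis.** With `dL` deciding `L''` in indicator format,
on the candidate of a run (answers = `f`-values of its queries) the indexed evaluator returns
`runHyp (learnerDesign …) (idxTest L'' z ℓ) f ω` — the hypothesis counted by `Learning.card_goodRun_ge`
for the test named by `z`. [cite: ImpagliazzoWigderson2001, Lemma 15] [cite: CarmosinoImpagliazzoKabanetsKolokolova2016, Thm. 5.1] -/
theorem evalFnIdx_candS {dL : List Bool → List Bool} {L'' : Language Bool}
    (hdL : ∀ u, dL u = encodeBool (L''.boolIndicator u)) (hκk : 2 ^ κ ≤ k) (hk : 0 < k)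
    (hrb : runLen n k ℓ kk t (qOf n k) κ ≤ rb.length) {nQ : ℕ} (hnQ : 2 ^ ℓ * 2 ^ ℓ * k + k ≤ nQ) (x : Fin n → Bool) :
    IWRecon.evalFnIdx dL (boolPair
        (candS kF LF ℓF kkF KKF κF tF (boolPair (boolPair (ones n) (boolPair z rb))
          ((List.range nQ).map fun u => f' (qryS kF LF ℓF kkF κF tF (boolPair (boolPair (ones n) rb) (ones u))))))
        (List.ofFn x)) =
      [runHyp (learnerDesign (qOf n k) n k ℓ (knk_le_qOf n k)) (IWRecon.idxTest L'' z ℓ) (fun v : Fin n → Bool => f' (List.ofFn v))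
        (coinsToRun n k ℓ kk t (qOf n k) κ hk (rb.take (runLen n k ℓ kk t (qOf n k) κ))) x] := by
  rw [candS_apply hkF hLF hℓF hkkF hKKF hκF htF z rb f' hκk hk hrb hnQ]
  refine IWRecon.evalFnIdx_apply dL (knk_le_qOf n k) hdL z _ _ _ (fun j hj => ?_) x
  rw [List.getD_eq_getElem?_getD, List.getElem?_ofFn, dif_pos j.isLt, Option.getD_some, Fin.eta]
  exact learnerTable_eq_tableList (knk_le_qOf n k) _ (fun h => by rw [h] at hj; exact lt_irrefl _ hj) _

end Values

end IWStage

end Literature.Computability.Complexity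

end
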